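import Mathlib.Algebra.DualNumber
import Mathlib.LinearAlgebra.Matrix.Charpoly.Coeff
import Mathlib.RingTheory.Nullstellensatz
import Literature.NumberTheory.Automorphic.RootDataRootsFiniteProofs
import Literature.NumberTheory.Automorphic.IdentityComponent
import HarnessLib

/-!
# The Lie algebra of an algebraic subgroup of `GL n k`; roots are weights (trunk T-AUTOMORPHIC, G25 AutomorphicL)

Companion to `LinearAlgebraicGroups.lean`, `IdentityComponent.lean` (for `conjPolyGL`),
`RootData.lean` and `RootDataRootsFiniteProofs.lean`
(namespace `Literature.Automorphic`, concrete `Subgroup (GL n k)` vocabulary). Springer, *Linear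
Algebraic Groups*, 2nd ed., defines the roots `R(G, T)` of a connected reductive group through
the set `P` of non-zero weights of the maximal torus `T` in the Lie algebra `𝔤` (7.1.1, 7.4.3,
8.1.2), whereas `RootData.roots G T` is defined through root homomorphisms (8.1.1 (i)). To state
the structure theorems of Springer ch. 7 faithfully (7.3.2: for `G` of semisimple rank one `P`
is a pair `±α`; 8.1.2: `R = P`) one needs `𝔤` and `P` in this vocabulary. This file provides
them, with real definitions and proofs only (no named facts):

* `lieAlgebraGL H : Submodule k (Matrix n n k)` — the Lie algebra `𝔥 ⊆ 𝔤𝔩ₙ` of a subgroup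
  `H ≤ GL n k`, i.e. the Zariski tangent space of (the closure of) `H` at `1` inside
  `𝔤𝔩ₙ = T_1 GL_n` (Springer 4.1.2–4.1.3, 4.4.10 (3)): the matrices `A` such that the
  `k[ε]`-valued point `1 + ε A` of `GL n` (coordinates `x i j ↦ δ i j + ε A i j`,
  `det⁻¹ ↦ 1 - ε tr A`) annihilates the vanishing ideal of `H` (Springer 4.1.9 (3): tangent
  vectors at `x` are the `k[ε]`-valued points lying over `x`); equivalently `d p_1 (A) = 0` for
  all `p ∈ 𝓘(H)`, where `tangentDeriv p A` is the `ε`-part of `p (1 + ε A)`, a linear form in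
  `A` (`tangentDerivLin`);
* `weightSpaceGL T χ`, `lieWeightSpace G T χ = 𝔤_χ` and `lieWeights G T = P` — the weight
  spaces of `T` acting on `𝔤𝔩ₙ` and on `𝔤` by conjugation (`Ad(t) A = t A t⁻¹`, 4.4.10 (3)) and
  Springer's set `P` of non-zero weights of `T` in `𝔤` (7.1.1);
* `coeffOneMatrix_mem_lieAlgebraGL` — the velocity at `x = 0` of a polynomial curve
  `γ : 𝔸¹ → G` with `γ 0 = 1` lies in `Lie(G)` (over an infinite field);
* `conj_mem_lieAlgebraGL` — `Lie(G)` is stable under `Ad(g) : A ↦ g A g⁻¹` for `g ∈ G`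
  (Springer 4.4.5 (ii), 4.4.10 (3); more generally for `g` normalising `G`,
  `conj_mem_lieAlgebraGL_of_forall_mem`); on the way, `mulPolyGL`/`conjPolyGL` are evaluated on
  points of `GL n` with values in any `k`-algebra (`aeval_mulPolyGL_coordsOf`,
  `aeval_conjPolyGL_coordsOf`) and `g (1 + ε A) g⁻¹ = 1 + ε g A g⁻¹` (`conj_dualMatrix`);
* `IsRootHom.exists_weightVector_mem_lieAlgebraGL_map_range`,
  `IsRootHom.exists_weightVector_mem_lieAlgebraGL` — for a root homomorphism `u` with character
  `α`, `du (d/dx)` is a non-zero element of `𝔤_α` (Springer 8.1.1 (i): `Im du_α = 𝔤_α`; this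
  strengthens `IsRootHom.exists_weightVector` of `RootDataRootsFiniteProofs.lean` by the
  membership in `Lie(G)`), whence `roots_subset_lieWeights : roots G T ⊆ P` (the inclusion
  `R ⊆ P` of 7.4.3/8.1.2 for the root-homomorphism definition of roots);
* sanity: `lieAlgebraGL_bot` (`Lie {1} = 0`), `lieAlgebraGL_mono`.

As in `LinearAlgebraicGroups.lean`, this `k`-points vocabulary is the textbook notion for `k`
algebraically closed (then `𝓘(H)` is the ideal of the closed subgroup `H̄` and `lieAlgebraGL H`
is its Lie algebra, of dimension `dim H̄`, Springer 4.4.5–4.4.6); the results of this file hold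
over any (infinite, where stated) field. Not included: `Lie(GL n) = 𝔤𝔩ₙ` (true; not needed
below) and the Lie bracket.

## References

* T. A. Springer, *Linear Algebraic Groups*, 2nd ed., Progress in Mathematics 9, Birkhäuser
  (1998), 4.1.2, 4.1.3, 4.1.9 (3), 4.4.5, 4.4.10 (3), 7.1.1, 7.4.3, 8.1.1, 8.1.2.
-/

open scoped DualNumber
open TrivSqZeroExt

namespace Literature.NumberTheory.Automorphic

variable {k : Type*} [Field k] {n : Type*} [Fintype n] [DecidableEq n]

/-! ### Dual-number points of `GL n` over `1` and differentials at `1` -/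

/-- The tangent vector of `GL n ⊂ 𝔸^(n × n) × 𝔸¹` (coordinates `x i j` and `det⁻¹`) at `1`
defined by a matrix `A ∈ 𝔤𝔩ₙ`: its `x i j`-coordinate is `A i j` and its `det⁻¹`-coordinate is
`- tr A` (the differential of `det⁻¹` at `1`; Springer 4.4.10 (3)). [folklore] -/
def tangentCoord (A : Matrix n n k) : GLCoord n → k :=
  Sum.elim (fun ij => A ij.1 ij.2) (fun _ => - Matrix.trace A)

/-- The `k[ε]`-valued point `1 + ε A` of `GL n` lying over `1`, in the coordinates `x i j, det⁻¹`
(Springer 4.1.9 (3)): `x i j ↦ δ i j + ε A i j`, `det⁻¹ ↦ 1 - ε tr A`. [folklore] -/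
def dualPoint (A : Matrix n n k) (c : GLCoord n) : k[ε] :=
  inl (glCoordFun (1 : GL n k) c) + inr (tangentCoord A c)

/-- The `k`-part of `1 + ε A` is the point `1`. [folklore] -/
@[simp] lemma fst_dualPoint (A : Matrix n n k) (c : GLCoord n) :
    fst (dualPoint A c) = glCoordFun (1 : GL n k) c := by
  simp [dualPoint]

/-- The `ε`-part of `1 + ε A` is the tangent vector of `A`. [folklore] -/
@[simp] lemma snd_dualPoint (A : Matrix n n k) (c : GLCoord n) :
    snd (dualPoint A c) = tangentCoord A c := by
  simp [dualPoint]

omit [DecidableEq n] in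
/-- `tangentCoord` is additive. [folklore] -/
lemma tangentCoord_add (A B : Matrix n n k) :
    tangentCoord (A + B) = tangentCoord A + tangentCoord B := by
  funext c; rcases c with ⟨i, j⟩ | ⟨⟩ <;> simp [tangentCoord, Matrix.trace_add]; ring

omit [DecidableEq n] in
/-- `tangentCoord` is homogeneous. [folklore] -/
lemma tangentCoord_smul (a : k) (A : Matrix n n k) :
    tangentCoord (a • A) = a • tangentCoord A := by
  funext c; rcases c with ⟨i, j⟩ | ⟨⟩ <;> simp [tangentCoord, Matrix.trace_smul]

/-- The `k`-part of `p (1 + ε A)` is `p (1)`. [folklore] -/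
lemma fst_aeval_dualPoint (A : Matrix n n k) (p : MvPolynomial (GLCoord n) k) :
    fst (MvPolynomial.aeval (dualPoint A) p) = MvPolynomial.eval (glCoordFun (1 : GL n k)) p := by
  have h := MvPolynomial.map_aeval (dualPoint A) (TrivSqZeroExt.fstHom k k k).toRingHom p
  simp only [AlgHom.toRingHom_eq_coe, RingHom.coe_coe, fstHom_apply, fst_dualPoint] at h
  have hc : ((TrivSqZeroExt.fstHom k k k : k[ε] →ₐ[k] k) : k[ε] →+* k).comp (algebraMap k k[ε]) =
      RingHom.id k :=
    RingHom.ext fun a => by simp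
  rw [h, hc]
  rfl

/-- The differential `d p_1 (A)` at `1` of a polynomial `p` in the coordinates of `GL n`,
evaluated on the tangent vector of `A`: the `ε`-part of `p (1 + ε A) ∈ k[ε]`
(Springer 4.1.2: `p (x + t v) ≡ p (x) + t Σ v_i (∂p/∂T_i)(x) mod t²`). [folklore] -/
noncomputable def tangentDeriv (p : MvPolynomial (GLCoord n) k) (A : Matrix n n k) : k :=
  snd (MvPolynomial.aeval (dualPoint A) p)

/-- Constants have zero differential. [folklore] -/
lemma tangentDeriv_C (a : k) (A : Matrix n n k) : tangentDeriv (MvPolynomial.C a) A = 0 := by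
  simp [tangentDeriv, TrivSqZeroExt.algebraMap_eq_inl]

/-- The differential is additive in `p`. [folklore] -/
lemma tangentDeriv_add (p q : MvPolynomial (GLCoord n) k) (A : Matrix n n k) :
    tangentDeriv (p + q) A = tangentDeriv p A + tangentDeriv q A := by
  simp [tangentDeriv]

/-- Leibniz rule for `p * x_c` at `1`. [folklore] -/
lemma tangentDeriv_mul_X (p : MvPolynomial (GLCoord n) k) (c : GLCoord n) (A : Matrix n n k) :
    tangentDeriv (p * MvPolynomial.X c) A =
      MvPolynomial.eval (glCoordFun (1 : GL n k)) p * tangentCoord A c +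
        tangentDeriv p A * glCoordFun (1 : GL n k) c := by
  simp only [tangentDeriv, map_mul, MvPolynomial.aeval_X, DualNumber.snd_mul, fst_dualPoint,
    snd_dualPoint, fst_aeval_dualPoint]

/-- `A ↦ d p_1 (A)` is `k`-linear (additive and homogeneous). [folklore] -/
lemma tangentDeriv_linear (p : MvPolynomial (GLCoord n) k) :
    (∀ A B : Matrix n n k, tangentDeriv p (A + B) = tangentDeriv p A + tangentDeriv p B) ∧
      ∀ (a : k) (A : Matrix n n k), tangentDeriv p (a • A) = a * tangentDeriv p A := by
  induction p using MvPolynomial.induction_on with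
  | C a => simp [tangentDeriv_C]
  | add p q hp hq =>
    refine ⟨fun A B => ?_, fun a A => ?_⟩
    · rw [tangentDeriv_add, tangentDeriv_add, tangentDeriv_add, hp.1, hq.1]; ring
    · rw [tangentDeriv_add, tangentDeriv_add, hp.2, hq.2]; ring
  | mul_X p c hp =>
    refine ⟨fun A B => ?_, fun a A => ?_⟩
    · rw [tangentDeriv_mul_X, tangentDeriv_mul_X, tangentDeriv_mul_X, hp.1, tangentCoord_add,
        Pi.add_apply]; ring
    · rw [tangentDeriv_mul_X, tangentDeriv_mul_X, hp.2, tangentCoord_smul, Pi.smul_apply,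
        smul_eq_mul]; ring

/-- The differential `d p_1 : 𝔤𝔩ₙ → k` at the identity of a polynomial `p` in the coordinates of
`GL n`, as a linear form on matrices (Springer 4.1.2–4.1.3). [folklore] -/
noncomputable def tangentDerivLin (p : MvPolynomial (GLCoord n) k) : Matrix n n k →ₗ[k] k where
  toFun := tangentDeriv p
  map_add' := (tangentDeriv_linear p).1
  map_smul' := (tangentDeriv_linear p).2

/-- Unfolding `tangentDerivLin`. [folklore] -/
@[simp] lemma tangentDerivLin_apply (p : MvPolynomial (GLCoord n) k) (A : Matrix n n k) :
    tangentDerivLin p A = tangentDeriv p A := rfl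

/-! ### The Lie algebra of a subgroup of `GL n k` -/

/-- The *Lie algebra* `Lie(H) ⊆ 𝔤𝔩ₙ` of a subgroup `H ≤ GL n k`: the tangent space at `1` of the
Zariski closure of `H` inside `T_1 GL_n = 𝔤𝔩ₙ = Matrix n n k` (Springer 4.1.3 with 4.1.2 for
closed subvarieties of affine space, and 4.4.10 (3): "if `H` is a closed subgroup of `GL_n` we
can view `𝔥` as a subalgebra of `𝔤𝔩ₙ`"), i.e. the matrices `A` with `d p_1 (A) = 0` for every
`p` in the vanishing ideal `𝓘(H)` (Mathlib's `MvPolynomial.vanishingIdeal` of the coordinates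
of `H`); equivalently (`mem_lieAlgebraGL_iff_aeval`) the `A` such that the `k[ε]`-valued point
`1 + ε A` annihilates `𝓘(H)` (Springer 4.1.9 (3)). Only the `k`-subspace structure is recorded
(the bracket is that of `𝔤𝔩ₙ`, not needed here). [cite: SpringerLAG1998, 4.1.3 and 4.4.10 (3)] -/
noncomputable def lieAlgebraGL (H : Subgroup (GL n k)) : Submodule k (Matrix n n k) :=
  ⨅ p ∈ MvPolynomial.vanishingIdeal k (glCoordFun '' (H : Set (GL n k))),
    LinearMap.ker (tangentDerivLin p)

/-- Membership in `Lie(H)`: all differentials of `𝓘(H)` vanish. [folklore] -/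
lemma mem_lieAlgebraGL_iff {H : Subgroup (GL n k)} {A : Matrix n n k} :
    A ∈ lieAlgebraGL H ↔
      ∀ p ∈ MvPolynomial.vanishingIdeal k (glCoordFun '' (H : Set (GL n k))),
        tangentDeriv p A = 0 := by
  simp [lieAlgebraGL]

/-- Membership in `Lie(H)` via dual numbers (Springer 4.1.9 (3)): `A ∈ Lie(H)` iff
`p (1 + ε A) = 0` in `k[ε]` for all `p ∈ 𝓘(H)`. [folklore] -/
lemma mem_lieAlgebraGL_iff_aeval {H : Subgroup (GL n k)} {A : Matrix n n k} :
    A ∈ lieAlgebraGL H ↔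
      ∀ p ∈ MvPolynomial.vanishingIdeal k (glCoordFun '' (H : Set (GL n k))),
        MvPolynomial.aeval (dualPoint A) p = 0 := by
  rw [mem_lieAlgebraGL_iff]
  refine forall₂_congr fun p hp => ?_
  have h1 : MvPolynomial.eval (glCoordFun (1 : GL n k)) p = 0 := by
    rw [MvPolynomial.mem_vanishingIdeal_iff] at hp
    exact hp _ ⟨1, H.one_mem, rfl⟩
  constructor
  · intro h
    exact TrivSqZeroExt.ext (by rw [fst_aeval_dualPoint, h1]; rfl)
      (by rw [← tangentDeriv.eq_1, h]; rfl)
  · intro h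
    rw [tangentDeriv, h]
    rfl

/-- The differential of a coordinate function is the corresponding coordinate of the tangent
vector. [folklore] -/
lemma tangentDeriv_X (c : GLCoord n) (A : Matrix n n k) :
    tangentDeriv (MvPolynomial.X c) A = tangentCoord A c := by
  simp [tangentDeriv]

/-- The differential is compatible with subtraction. [folklore] -/
lemma tangentDeriv_sub (p q : MvPolynomial (GLCoord n) k) (A : Matrix n n k) :
    tangentDeriv (p - q) A = tangentDeriv p A - tangentDeriv q A := by
  simp [tangentDeriv]

/-- The Lie algebra of the trivial subgroup is zero: the equations `x i j = δ i j` of `{1}` have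
differentials `A ↦ A i j` (Springer 4.1.2). [folklore] -/
lemma lieAlgebraGL_bot : lieAlgebraGL (⊥ : Subgroup (GL n k)) = ⊥ := by
  refine (Submodule.eq_bot_iff _).2 fun A hA => ?_
  rw [mem_lieAlgebraGL_iff] at hA
  ext i j
  have hmem : MvPolynomial.X (Sum.inl (i, j)) - MvPolynomial.C ((1 : Matrix n n k) i j) ∈
      MvPolynomial.vanishingIdeal k (glCoordFun '' ((⊥ : Subgroup (GL n k)) : Set (GL n k))) := by
    rw [MvPolynomial.mem_vanishingIdeal_iff]
    rintro _ ⟨g, hg, rfl⟩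
    rw [SetLike.mem_coe, Subgroup.mem_bot] at hg
    subst hg
    simp
  have h := hA _ hmem
  rw [tangentDeriv_sub, tangentDeriv_X, tangentDeriv_C, sub_zero] at h
  simpa [tangentCoord] using h

/-- `Lie` is monotone: `H ≤ H'` implies `Lie(H) ≤ Lie(H')` (Springer 4.4.7). [folklore] -/
lemma lieAlgebraGL_mono {H H' : Subgroup (GL n k)} (h : H ≤ H') :
    lieAlgebraGL H ≤ lieAlgebraGL H' := by
  intro A hA
  rw [mem_lieAlgebraGL_iff] at hA ⊢
  intro p hp
  exact hA p (MvPolynomial.vanishingIdeal_anti_mono (Set.image_mono (SetLike.coe_subset_coe.2 h)) hp)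

/-! ### Tangent vectors of polynomial curves -/

section Curve

open Polynomial

omit [Fintype n] [DecidableEq n] in
/-- `ε · a = a ε` in `k[ε]`. [folklore] -/
lemma eps_mul_inl (x : k) : (ε : k[ε]) * inl x = inr x :=
  TrivSqZeroExt.ext (by simp) (by simp)

omit [Fintype n] [DecidableEq n] in
/-- Evaluating a polynomial `q (X)` at `ε ∈ k[ε]` keeps exactly its constant and linear terms:
`q (ε) = q (0) + q' (0) ε`. [folklore] -/
lemma aeval_eps_eq (q : k[X]) :
    Polynomial.aeval (ε : k[ε]) q = inl (q.coeff 0) + inr (q.coeff 1) := by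
  conv_lhs => rw [← X_mul_divX_add q, ← X_mul_divX_add q.divX]
  simp only [map_add, map_mul, Polynomial.aeval_X, Polynomial.aeval_C, coeff_divX, zero_add,
    TrivSqZeroExt.algebraMap_eq_inl]
  rw [mul_add, ← mul_assoc, DualNumber.eps_mul_eps, zero_mul, zero_add, eps_mul_inl, add_comm]

variable {G : Subgroup (GL n k)}

/-- **The velocity of a polynomial curve in `G` through `1` lies in `Lie(G)`.** If
`γ : 𝔸¹ → G` has polynomial coordinates `P c ∈ k[X]` and `γ 0 = 1` (over an infinite field),
then the matrix `A = (P'_{ij}(0))` of linear coefficients of its entries lies in `lieAlgebraGL G`: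
for `p ∈ 𝓘(G)` the polynomial `p (γ (X)) ∈ k[X]` vanishes identically, and its image under
`X ↦ ε` is `p (1 + ε A)`, because the `det⁻¹`-coordinate of `γ` has linear term `- tr A`
(`det (1 + ε A) = 1 + ε tr A`, Mathlib `Matrix.det_one_add_smul`). This is `dγ (d/dx) ∈ T_1 G`
(Springer 4.1.3, 4.4.9) in coordinates. [folklore] -/
theorem coeffOneMatrix_mem_lieAlgebraGL [Infinite k] (γ : k → ↥G) (P : GLCoord n → k[X])
    (hP : ∀ (x : k) (c : GLCoord n), glCoordFun ((γ x : ↥G) : GL n k) c = (P c).eval x)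
    (h0 : γ 0 = 1) :
    Matrix.of (fun i j => (P (Sum.inl (i, j))).coeff 1) ∈ lieAlgebraGL G := by
  set A : Matrix n n k := Matrix.of (fun i j => (P (Sum.inl (i, j))).coeff 1) with hA
  -- constant terms: the coordinates of `γ 0 = 1`
  have hP0 : ∀ c, (P c).coeff 0 = glCoordFun (1 : GL n k) c := fun c => by
    rw [Polynomial.coeff_zero_eq_eval_zero, ← hP 0 c, h0]; rfl
  have hφ : ∀ c, Polynomial.aeval (ε : k[ε]) (P c) = dualPoint A c + inr
      (Sum.elim (fun _ => (0 : k)) (fun _ => (P (Sum.inr ())).coeff 1 + Matrix.trace A) c) := by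
    intro c
    rw [aeval_eps_eq, hP0, dualPoint, add_assoc, ← inr_add]
    rcases c with ⟨i, j⟩ | ⟨⟩
    · simp [tangentCoord, hA]
    · simp [tangentCoord]
  -- linear term of the `det⁻¹` coordinate
  have hdet : (P (Sum.inr ())).coeff 1 + Matrix.trace A = 0 := by
    set M : Matrix n n k[X] := Matrix.of fun a b => P (Sum.inl (a, b)) with hM
    have hMD : P (Sum.inr ()) * M.det = 1 := by
      apply Polynomial.funext
      intro x
      have h1 : M.det.eval x = (((γ x : ↥G) : GL n k) : Matrix n n k).det := by
        rw [← Polynomial.coe_evalRingHom, RingHom.map_det]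
        congr 1
        ext a b
        simp only [RingHom.mapMatrix_apply, Matrix.map_apply, hM, Matrix.of_apply,
          Polynomial.coe_evalRingHom, ← hP x (Sum.inl (a, b)), glCoordFun_inl]
      have h2 : (P (Sum.inr ())).eval x = ((((γ x : ↥G) : GL n k) : Matrix n n k).det)⁻¹ := by
        simpa using (hP x (Sum.inr ())).symm
      rw [Polynomial.eval_mul, Polynomial.eval_one, h1, h2, inv_mul_cancel₀]
      exact (Matrix.isUnits_det_units _).ne_zero
    have hMe : ((Polynomial.aeval (ε : k[ε]) : k[X] →ₐ[k] k[ε]) : k[X] →+* k[ε]).mapMatrix M =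
        1 + (ε : k[ε]) • A.map (algebraMap k k[ε]) := by
      ext1 a b
      rw [RingHom.mapMatrix_apply, Matrix.map_apply, hM, Matrix.of_apply, RingHom.coe_coe, hφ,
        dualPoint, Matrix.add_apply, Matrix.smul_apply, Matrix.map_apply, smul_eq_mul,
        TrivSqZeroExt.algebraMap_eq_inl, eps_mul_inl]
      simp only [Sum.elim_inl, inr_zero, add_zero, glCoordFun_inl, Units.val_one, tangentCoord]
      congr 1
      rw [Matrix.one_apply, Matrix.one_apply]
      split_ifs <;> simp
    have h := congrArg ((Polynomial.aeval (ε : k[ε]) : k[X] →ₐ[k] k[ε]) : k[X] →+* k[ε]) hMD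
    rw [map_mul, map_one, RingHom.map_det, hMe, Matrix.det_one_add_smul,
      DualNumber.eps_pow_two, mul_zero, add_zero, RingHom.coe_coe, hφ, ← AddMonoidHom.map_trace]
      at h
    have h' := congrArg snd h
    simp only [DualNumber.snd_mul, snd_add, fst_add, fst_dualPoint, snd_dualPoint, snd_inr, fst_inr,
      snd_one, fst_one, DualNumber.snd_eps, DualNumber.fst_eps, TrivSqZeroExt.algebraMap_eq_inl,
      fst_inl, snd_inl, Sum.elim_inr, tangentCoord, glCoordFun_inr, Units.val_one, Matrix.det_one,
      inv_one, TrivSqZeroExt.fst_mul, mul_zero, add_zero, zero_add, mul_one, one_mul] at h'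
    linear_combination h'
  rw [mem_lieAlgebraGL_iff_aeval]
  intro p hp
  -- `p ∘ γ = 0` as a polynomial in `x`
  have hpγ : MvPolynomial.eval₂ Polynomial.C P p = 0 := by
    apply Polynomial.funext
    intro x
    rw [eval_mvPolynomialEval₂_C, Polynomial.eval_zero]
    have hglc : glCoordFun (((γ x : ↥G) : GL n k)) = fun c => (P c).eval x := funext (hP x)
    rw [← hglc]
    exact (MvPolynomial.mem_vanishingIdeal_iff.1 hp) _ ⟨_, (γ x).2, rfl⟩
  -- push through `k[X] → k[ε]`, `X ↦ ε`
  have h := congrArg (Polynomial.aeval (ε : k[ε])) hpγ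
  rw [map_zero, ← MvPolynomial.coe_eval₂Hom, ← AlgHom.coe_toRingHom, MvPolynomial.map_eval₂Hom]
    at h
  have hC : ((Polynomial.aeval (ε : k[ε]) : k[X] →ₐ[k] k[ε]) : k[X] →+* k[ε]).comp Polynomial.C =
      algebraMap k k[ε] := RingHom.ext fun a => by simp
  have hpt : (fun c => ((Polynomial.aeval (ε : k[ε]) : k[X] →ₐ[k] k[ε]) : k[X] →+* k[ε]) (P c)) = dualPoint A := by
    funext c
    rw [RingHom.coe_coe, hφ c]
    rcases c with ⟨i, j⟩ | ⟨⟩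
    · simp
    · rw [Sum.elim_inr, hdet, inr_zero, add_zero]
  rw [hC, hpt, MvPolynomial.coe_eval₂Hom, ← MvPolynomial.aeval_def] at h
  exact h

end Curve

/-! ### Points of `GL n` over a `k`-algebra and the adjoint action on `Lie(G)` -/

section Ad

/-- The coordinate vector (entries, and a value for the coordinate `det⁻¹`) of a matrix `M` over a
`k`-algebra `R` together with `y : R`; for `y = (det M)⁻¹` these are the coordinates of the
`R`-valued point `M` of `GL n`. [folklore] -/
def coordsOf {R : Type*} (M : Matrix n n R) (y : R) : GLCoord n → R :=
  Sum.elim (fun ij => M ij.1 ij.2) (fun _ => y)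

omit [Fintype n] [DecidableEq n] in
/-- The entry coordinates of `coordsOf M y`. [folklore] -/
@[simp] lemma coordsOf_inl {R : Type*} (M : Matrix n n R) (y : R) (i j : n) :
    coordsOf M y (Sum.inl (i, j)) = M i j := rfl

omit [Fintype n] [DecidableEq n] in
/-- The `det⁻¹` coordinate of `coordsOf M y`. [folklore] -/
@[simp] lemma coordsOf_inr {R : Type*} (M : Matrix n n R) (y : R) (u : Unit) :
    coordsOf M y (Sum.inr u) = y := rfl

/-- The coordinates of `g ∈ GL n k`, viewed in a `k`-algebra `R`. [folklore] -/
lemma algebraMap_comp_glCoordFun {R : Type*} [CommRing R] [Algebra k R] (g : GL n k) :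
    (fun c => algebraMap k R (glCoordFun g c)) =
      coordsOf ((g : Matrix n n k).map (algebraMap k R)) (algebraMap k R ((g : Matrix n n k).det)⁻¹) := by
  funext c; rcases c with ⟨i, j⟩ | ⟨⟩ <;> rfl

omit [DecidableEq n] in
/-- `mulPolyGL` computes products of points of `GL n` with values in any `k`-algebra. [folklore] -/
lemma aeval_mulPolyGL_coordsOf {R : Type*} [CommRing R] [Algebra k R] (M M' : Matrix n n R)
    (y y' : R) (c : GLCoord n) :
    MvPolynomial.aeval (Sum.elim (coordsOf M y) (coordsOf M' y')) (mulPolyGL (k := k) c) =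
      coordsOf (M * M') (y * y') c := by
  rcases c with ⟨i, j⟩ | ⟨⟩
  · simp [mulPolyGL, Matrix.mul_apply]
  · simp [mulPolyGL]

/-- `leftMulPolyGL h` computes `h * M` on points with values in any `k`-algebra. [folklore] -/
lemma aeval_leftMulPolyGL_coordsOf {R : Type*} [CommRing R] [Algebra k R] (h : GL n k)
    (M : Matrix n n R) (y : R) (c : GLCoord n) :
    MvPolynomial.aeval (coordsOf M y) (leftMulPolyGL h c) =
      coordsOf ((h : Matrix n n k).map (algebraMap k R) * M)
        (algebraMap k R ((h : Matrix n n k).det)⁻¹ * y) c := by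
  rw [leftMulPolyGL, MvPolynomial.aeval_bind₁]
  have hf : (fun i => MvPolynomial.aeval (coordsOf M y)
      (Sum.elim (fun d => MvPolynomial.C (glCoordFun h d)) MvPolynomial.X i)) =
      Sum.elim (fun c => algebraMap k R (glCoordFun h c)) (coordsOf M y) := by
    funext i; rcases i with d | d <;> simp
  rw [hf, algebraMap_comp_glCoordFun, aeval_mulPolyGL_coordsOf]

/-- `conjPolyGL h h'` computes `h * M * h'` on points with values in any `k`-algebra. [folklore] -/
lemma aeval_conjPolyGL_coordsOf {R : Type*} [CommRing R] [Algebra k R] (h h' : GL n k)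
    (M : Matrix n n R) (y : R) (c : GLCoord n) :
    MvPolynomial.aeval (coordsOf M y) (conjPolyGL h h' c) =
      coordsOf ((h : Matrix n n k).map (algebraMap k R) * M * (h' : Matrix n n k).map (algebraMap k R))
        (algebraMap k R ((h : Matrix n n k).det)⁻¹ * y *
          algebraMap k R ((h' : Matrix n n k).det)⁻¹) c := by
  rw [conjPolyGL, MvPolynomial.aeval_bind₁]
  have hf : (fun i => MvPolynomial.aeval (coordsOf M y)
      (Sum.elim (leftMulPolyGL h) (fun d => MvPolynomial.C (glCoordFun h' d)) i)) =
      Sum.elim (coordsOf ((h : Matrix n n k).map (algebraMap k R) * M)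
        (algebraMap k R ((h : Matrix n n k).det)⁻¹ * y)) (fun c => algebraMap k R (glCoordFun h' c)) := by
    funext i
    rcases i with d | d
    · simp [aeval_leftMulPolyGL_coordsOf]
    · simp
  rw [hf, algebraMap_comp_glCoordFun, aeval_mulPolyGL_coordsOf]

/-- The `k[ε]`-matrix `1 + ε A`. [folklore] -/
def dualMatrix (A : Matrix n n k) : Matrix n n k[ε] := 1 + A.map inr

/-- The point `1 + ε A` in coordinates: entries `1 + ε A`, `det⁻¹ = 1 - ε tr A`. [folklore] -/
lemma dualPoint_eq_coordsOf (A : Matrix n n k) :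
    dualPoint A = coordsOf (dualMatrix A) (inl 1 + inr (- Matrix.trace A)) := by
  funext c
  rcases c with ⟨i, j⟩ | ⟨⟩
  · simp only [dualPoint, glCoordFun_inl, Units.val_one, tangentCoord, Sum.elim_inl, coordsOf_inl,
      dualMatrix, Matrix.add_apply, Matrix.map_apply]
    rw [Matrix.one_apply, Matrix.one_apply]
    split_ifs <;> simp
  · simp [dualPoint, tangentCoord]

omit [DecidableEq n] in
/-- `M · (ε N) = ε (M N)` for matrices over `k[ε]`. [folklore] -/
lemma map_algebraMap_mul_map_inr (M N : Matrix n n k) :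
    M.map (algebraMap k k[ε]) * N.map inr = (M * N).map inr := by
  refine Matrix.ext fun i j => ?_
  simp only [Matrix.mul_apply, Matrix.map_apply, TrivSqZeroExt.algebraMap_eq_inl, inl_mul_inr,
    smul_eq_mul]
  exact (map_sum (inrHom k k) (fun x => M i x * N x j) Finset.univ).symm

omit [DecidableEq n] in
/-- `(ε M) · N = ε (M N)` for matrices over `k[ε]`. [folklore] -/
lemma map_inr_mul_map_algebraMap (M N : Matrix n n k) :
    M.map (inr : k → k[ε]) * N.map (algebraMap k k[ε]) = (M * N).map inr := by
  refine Matrix.ext fun i j => ?_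
  simp only [Matrix.mul_apply, Matrix.map_apply, TrivSqZeroExt.algebraMap_eq_inl, inr_mul_inl,
    MulOpposite.smul_eq_mul_unop, MulOpposite.unop_op]
  exact (map_sum (inrHom k k) (fun x => M i x * N x j) Finset.univ).symm

/-- `h (1 + ε A) h⁻¹ = 1 + ε (h A h⁻¹)`. [folklore] -/
lemma conj_dualMatrix (h : GL n k) (A : Matrix n n k) :
    (h : Matrix n n k).map (algebraMap k k[ε]) * dualMatrix A *
        ((h⁻¹ : GL n k) : Matrix n n k).map (algebraMap k k[ε]) =
      dualMatrix ((h : Matrix n n k) * A * ((h⁻¹ : GL n k) : Matrix n n k)) := by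
  rw [dualMatrix, dualMatrix, Matrix.mul_add, Matrix.add_mul, Matrix.mul_one, ← Matrix.map_mul,
    ← Units.val_mul, mul_inv_cancel, Units.val_one, map_algebraMap_mul_map_inr,
    map_inr_mul_map_algebraMap, Matrix.map_one _ (map_zero _) (map_one _)]

/-- The determinant coordinate of `h (1 + ε A) h⁻¹`. [folklore] -/
lemma det_coord_conj (h : GL n k) (z : k[ε]) :
    algebraMap k k[ε] ((h : Matrix n n k).det)⁻¹ * z *
        algebraMap k k[ε] (((h⁻¹ : GL n k) : Matrix n n k).det)⁻¹ = z := by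
  rw [mul_comm, ← mul_assoc, ← map_mul, Matrix.coe_units_inv, Matrix.det_nonsing_inv,
    Ring.inverse_eq_inv', inv_inv, mul_inv_cancel₀ (Matrix.isUnits_det_units h).ne_zero, map_one,
    one_mul]

/-- `conjPolyGL h h⁻¹` maps the point `1 + ε A` to the point `1 + ε (h A h⁻¹)`. [folklore] -/
lemma aeval_dualPoint_conjPolyGL (A : Matrix n n k) (h : GL n k) (c : GLCoord n) :
    MvPolynomial.aeval (dualPoint A) (conjPolyGL h h⁻¹ c) =
      dualPoint ((h : Matrix n n k) * A * ((h⁻¹ : GL n k) : Matrix n n k)) c := by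
  rw [dualPoint_eq_coordsOf, dualPoint_eq_coordsOf, aeval_conjPolyGL_coordsOf, conj_dualMatrix,
    Matrix.trace_units_conj, det_coord_conj]

/-- **`Lie(G)` is stable under conjugation by elements normalising `G`**: if `g x g⁻¹ ∈ G` for
all `x ∈ G` and `A ∈ Lie(G)`, then `g A g⁻¹ ∈ Lie(G)` (Springer 4.4.5 (ii), 4.4.10 (3):
`Ad(x) X = x X x⁻¹` on `𝔤 ⊆ 𝔤𝔩ₙ`; e.g. a torus `T` normalising a root subgroup `U` acts on
`Lie(U)`). Proof: for `p ∈ 𝓘(G)` the polynomial `p (g · g⁻¹)` lies in `𝓘(G)`, and its value at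
the point `1 + ε A` is the value of `p` at `g (1 + ε A) g⁻¹ = 1 + ε g A g⁻¹`. [folklore] -/
theorem conj_mem_lieAlgebraGL_of_forall_mem {G : Subgroup (GL n k)} {g : GL n k}
    (hg : ∀ x ∈ G, g * x * g⁻¹ ∈ G) {A : Matrix n n k} (hA : A ∈ lieAlgebraGL G) :
    (g : Matrix n n k) * A * ((g⁻¹ : GL n k) : Matrix n n k) ∈ lieAlgebraGL G := by
  rw [mem_lieAlgebraGL_iff_aeval] at hA ⊢
  intro p hp
  -- `p ∘ (g · g⁻¹) ∈ 𝓘(G)`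
  have hp' : MvPolynomial.bind₁ (conjPolyGL g g⁻¹) p ∈
      MvPolynomial.vanishingIdeal k (glCoordFun '' (G : Set (GL n k))) := by
    rw [MvPolynomial.mem_vanishingIdeal_iff] at hp ⊢
    rintro _ ⟨x, hx, rfl⟩
    rw [MvPolynomial.aeval_bind₁]
    have hfun : (fun i => MvPolynomial.aeval (glCoordFun x) (conjPolyGL g g⁻¹ i)) =
        glCoordFun (g * x * g⁻¹) := by
      funext i
      exact eval_conjPolyGL g g⁻¹ x i
    rw [hfun]
    exact hp _ ⟨_, hg x hx, rfl⟩
  have h := hA _ hp'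
  rw [MvPolynomial.aeval_bind₁] at h
  have hpt : (fun i => MvPolynomial.aeval (dualPoint A) (conjPolyGL g g⁻¹ i)) =
      dualPoint ((g : Matrix n n k) * A * ((g⁻¹ : GL n k) : Matrix n n k)) :=
    funext (aeval_dualPoint_conjPolyGL A g)
  rw [hpt] at h
  exact h

/-- **`Lie(G)` is stable under `Ad(G)`**: for `g ∈ G` and `A ∈ Lie(G)`, `g A g⁻¹ ∈ Lie(G)`
(Springer 4.4.5 (ii), 4.4.10 (3): `Ad(x) X = x X x⁻¹` on `𝔤 ⊆ 𝔤𝔩ₙ`); the case `g ∈ G` of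
`conj_mem_lieAlgebraGL_of_forall_mem`. [folklore] -/
theorem conj_mem_lieAlgebraGL {G : Subgroup (GL n k)} {g : GL n k} (hg : g ∈ G) {A : Matrix n n k}
    (hA : A ∈ lieAlgebraGL G) :
    (g : Matrix n n k) * A * ((g⁻¹ : GL n k) : Matrix n n k) ∈ lieAlgebraGL G :=
  conj_mem_lieAlgebraGL_of_forall_mem (fun _ hx => G.mul_mem (G.mul_mem hg hx) (G.inv_mem hg)) hA

/-- The weight spaces `𝔤_χ` make sense: `T ≤ G` acts on `Lie(G)` by `Ad` (conjugation).
[folklore] -/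
theorem conj_mem_lieAlgebraGL_of_le {G T : Subgroup (GL n k)} (hTG : T ≤ G) (t : ↥T)
    {A : Matrix n n k} (hA : A ∈ lieAlgebraGL G) :
    ((t : GL n k) : Matrix n n k) * A * ((t : GL n k) : Matrix n n k)⁻¹ ∈ lieAlgebraGL G := by
  have h := conj_mem_lieAlgebraGL (hTG t.2) hA
  rwa [Matrix.coe_units_inv] at h

end Ad

/-! ### Weights of `T` on the Lie algebra; root homomorphisms give root vectors -/

section Weights

variable (G T : Subgroup (GL n k))

/-- The weight space of a character `χ` of `T ≤ GL n k` for the adjoint (conjugation) action of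
`T` on `𝔤𝔩ₙ` (`Ad(t) A = t A t⁻¹`, Springer 4.4.10 (3)): the matrices `A` with
`t A t⁻¹ = χ(t) A` for all `t ∈ T` (Springer 7.1.1). [folklore] -/
def weightSpaceGL (χ : ↥T →* kˣ) : Submodule k (Matrix n n k) where
  carrier := {A | ∀ t : ↥T,
    ((t : GL n k) : Matrix n n k) * A * ((t : GL n k) : Matrix n n k)⁻¹ = ((χ t : kˣ) : k) • A}
  zero_mem' t := by simp
  add_mem' {A B} hA hB t := by rw [Matrix.mul_add, Matrix.add_mul, hA t, hB t, smul_add]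
  smul_mem' a {A} hA t := by
    rw [Matrix.mul_smul, Matrix.smul_mul, hA t, smul_comm]

variable {G T} in
/-- Membership in the weight space `(𝔤𝔩ₙ)_χ`. [folklore] -/
lemma mem_weightSpaceGL_iff {χ : ↥T →* kˣ} {A : Matrix n n k} :
    A ∈ weightSpaceGL T χ ↔ ∀ t : ↥T,
      ((t : GL n k) : Matrix n n k) * A * ((t : GL n k) : Matrix n n k)⁻¹ = ((χ t : kˣ) : k) • A :=
  Iff.rfl

/-- The weight space `𝔤_χ = {A ∈ Lie(G) | Ad(t) A = χ(t) A for t ∈ T}` of `T` in the Lie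
algebra of `G` (Springer 7.1.1, 7.3.2, 8.1.1). [folklore] -/
noncomputable def lieWeightSpace (χ : ↥T →* kˣ) : Submodule k (Matrix n n k) :=
  lieAlgebraGL G ⊓ weightSpaceGL T χ

/-- Springer's set `P = P(G, T)` of *non-zero weights* of `T` in the Lie algebra `𝔤` of `G`
(7.1.1: "we denote by `P` the set of nonzero weights of `T` in `𝔤`"), as a set of algebraic
characters of `T` (written multiplicatively, so "non-zero" reads `χ ≠ 1`): those `χ ≠ 1` with
`𝔤_χ ≠ 0`. For `G` connected reductive over an algebraically closed field and `T` a maximal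
torus, `P` is the root system `R(G, T)` (Springer 8.1.2). [cite: SpringerLAG1998, 7.1.1] -/
def lieWeights : Set ↥(characterLattice T) :=
  {χ | (χ : ↥T →* kˣ) ≠ 1 ∧ lieWeightSpace G T χ ≠ ⊥}

variable {G T}

/-- `χ ∈ P` iff `χ ≠ 1` and some non-zero `A ∈ Lie(G)` has `t A t⁻¹ = χ(t) A` for all `t ∈ T`.
[folklore] -/
lemma mem_lieWeights_iff {χ : ↥(characterLattice T)} :
    χ ∈ lieWeights G T ↔ (χ : ↥T →* kˣ) ≠ 1 ∧
      ∃ A ∈ lieAlgebraGL G, A ≠ 0 ∧ A ∈ weightSpaceGL T χ := by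
  simp only [lieWeights, Set.mem_setOf_eq, ne_eq, Submodule.eq_bot_iff, not_forall, lieWeightSpace,
    Submodule.mem_inf, exists_prop]
  refine and_congr_right fun _ => ⟨?_, ?_⟩
  · rintro ⟨A, ⟨hA, hw⟩, h0⟩
    exact ⟨A, hA, h0, hw⟩
  · rintro ⟨A, hA, h0, hw⟩
    exact ⟨A, ⟨hA, hw⟩, h0⟩

open Polynomial in
/-- **Root homomorphisms give root vectors** (Springer 8.1.1 (i): `Im du_α = 𝔤_α`; here the
inclusion `Im du_α ⊆ 𝔤_α` together with `du_α ≠ 0`). If `u : 𝔾ₐ → G` is a root homomorphism for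
the character `α` of `T` over an infinite field, the matrix `A = du(d/dx)` of linear coefficients
of the entries of `u x` is a non-zero element of the Lie algebra `Lie(u(𝔾ₐ))` of the subgroup
`u(𝔾ₐ) ≤ G` (hence of `Lie(G)`) with `t A t⁻¹ = α(t) A` for `t ∈ T`. The non-vanishing uses the
regular retraction in `IsRootHom`; compare `IsRootHom.exists_weightVector`
(`RootDataRootsFiniteProofs.lean`), which omits the membership in the Lie algebra.
[cite: SpringerLAG1998, 8.1.1 (i)] -/
theorem IsRootHom.exists_weightVector_mem_lieAlgebraGL_map_range [Infinite k] {hTG : T ≤ G}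
    {α : ↥T →* kˣ} {u : Multiplicative k →* ↥G} (hu : IsRootHom G T hTG α u) :
    ∃ A ∈ lieAlgebraGL (u.range.map G.subtype), A ≠ 0 ∧ A ∈ weightSpaceGL T α := by
  obtain ⟨⟨P, hP⟩, ⟨q, hq⟩, hconj⟩ := hu
  have hentry : ∀ (x : k) (a b : n),
      (((u (Multiplicative.ofAdd x) : ↥G) : GL n k) : Matrix n n k) a b =
        (P (Sum.inl (a, b))).eval x :=
    fun x a b => by simpa using hP x (Sum.inl (a, b))
  -- the curve `x ↦ u x` inside the subgroup `u(𝔾ₐ)` itself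
  have hmem : ∀ x : k, ((u (Multiplicative.ofAdd x) : ↥G) : GL n k) ∈ u.range.map G.subtype :=
    fun x => ⟨u (Multiplicative.ofAdd x), ⟨_, rfl⟩, rfl⟩
  refine ⟨Matrix.of fun a b => (P (Sum.inl (a, b))).coeff 1,
    coeffOneMatrix_mem_lieAlgebraGL (G := u.range.map G.subtype)
      (fun x => ⟨((u (Multiplicative.ofAdd x) : ↥G) : GL n k), hmem x⟩) P hP
      (Subtype.ext (by simp)), ?_, ?_⟩
  · -- the linear coefficient matrix is non-zero, by the retraction `q`
    intro hA
    have hA' : ∀ a b : n, (P (Sum.inl (a, b))).coeff 1 = 0 := fun a b => by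
      simpa using congrFun (congrFun hA a) b
    -- the `det⁻¹` coordinate polynomial is a unit of `k[X]`, hence constant
    have hdet : (P (Sum.inr ())).coeff 1 = 0 := by
      set M : Matrix n n k[X] := Matrix.of fun a b => P (Sum.inl (a, b)) with hM
      have hMD : ∀ x : k, ((P (Sum.inr ())) * M.det).eval x = (1 : k[X]).eval x := by
        intro x
        have h1 : M.det.eval x =
            ((((u (Multiplicative.ofAdd x) : ↥G) : GL n k) : Matrix n n k)).det := by
          rw [← Polynomial.coe_evalRingHom, RingHom.map_det]
          congr 1
          ext a b
          simp [hM, hentry]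
        have h2 : (P (Sum.inr ())).eval x =
            (((((u (Multiplicative.ofAdd x) : ↥G) : GL n k) : Matrix n n k)).det)⁻¹ := by
          simpa using (hP x (Sum.inr ())).symm
        rw [Polynomial.eval_mul, Polynomial.eval_one, h1, h2, inv_mul_cancel₀]
        exact (Matrix.isUnits_det_units _).ne_zero
      have hunit : IsUnit (P (Sum.inr ())) :=
        IsUnit.of_mul_eq_one M.det (Polynomial.funext hMD)
      obtain ⟨r, -, hr⟩ := Polynomial.isUnit_iff.mp hunit
      simp [← hr]
    have hall : ∀ c, (P c).coeff 1 = 0 := by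
      rintro (⟨a, b⟩ | ⟨⟩)
      · exact hA' a b
      · exact hdet
    -- substituting the coordinates into the retraction gives the polynomial `X`
    have hQ : MvPolynomial.eval₂ Polynomial.C P q = X := by
      apply Polynomial.funext
      intro x
      rw [eval_mvPolynomialEval₂_C, Polynomial.eval_X]
      have hglc : glCoordFun (((u (Multiplicative.ofAdd x) : ↥G) : GL n k)) =
          fun c => (P c).eval x := funext (hP x)
      rw [← hglc]
      exact hq x
    have h01 := coeff_one_mvPolynomialEval₂_C_eq_zero P hall q
    rw [hQ, Polynomial.coeff_X_one] at h01
    exact one_ne_zero h01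
  · -- comparing linear coefficients in `t u(x) t⁻¹ = u (α(t) x)`
    intro t
    ext i j
    have hpoly : (∑ b, (∑ a, C (((t : GL n k) : Matrix n n k) i a) * P (Sum.inl (a, b))) *
          C (((t : GL n k) : Matrix n n k)⁻¹ b j)) =
        (P (Sum.inl (i, j))).comp (C ((α t : kˣ) : k) * X) := by
      apply Polynomial.funext
      intro x
      have h := congrArg (fun g : ↥G => ((g : GL n k) : Matrix n n k) i j) (hconj t x)
      simp only [Subgroup.coe_mul, Subgroup.coe_inv, Subgroup.coe_inclusion, Units.val_mul,
        Matrix.coe_units_inv, Matrix.mul_apply, hentry] at h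
      simpa only [Polynomial.eval_finsetSum, Polynomial.eval_mul, Polynomial.eval_C,
        Polynomial.eval_comp, Polynomial.eval_X] using h
    have hcoeff := congrArg (fun p : k[X] => p.coeff 1) hpoly
    simp only [Polynomial.finsetSum_coeff, Polynomial.coeff_mul_C, Polynomial.coeff_C_mul,
      Polynomial.comp_C_mul_X_coeff, pow_one] at hcoeff
    simp only [Matrix.mul_apply, Matrix.of_apply, Matrix.smul_apply, smul_eq_mul]
    rw [hcoeff, mul_comm]

/-- **Root homomorphisms give root vectors in `Lie(G)`**: the weight vector of
`exists_weightVector_mem_lieAlgebraGL_map_range` lies in `Lie(G) ⊇ Lie(u(𝔾ₐ))`.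
[cite: SpringerLAG1998, 8.1.1 (i)] -/
theorem IsRootHom.exists_weightVector_mem_lieAlgebraGL [Infinite k] {hTG : T ≤ G} {α : ↥T →* kˣ}
    {u : Multiplicative k →* ↥G} (hu : IsRootHom G T hTG α u) :
    ∃ A ∈ lieAlgebraGL G, A ≠ 0 ∧ A ∈ weightSpaceGL T α := by
  obtain ⟨A, hA, hA0, hAw⟩ := hu.exists_weightVector_mem_lieAlgebraGL_map_range
  have hle : u.range.map G.subtype ≤ G := by
    rintro _ ⟨y, -, rfl⟩; exact y.2
  exact ⟨A, lieAlgebraGL_mono hle hA, hA0, hAw⟩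

/-- **Roots are non-zero weights of `T` on the Lie algebra** (the inclusion `R(G, T) ⊆ P` of
Springer 7.4.3 — "`R = R(G, T)` equals `P'`" with `P' ⊆ P`, 7.1.4 — and 8.1.2, here for the roots
defined through root homomorphisms as in 8.1.1 (i)): over an infinite field, every root of
`(G, T)` in the sense of `roots G T` is a non-zero weight of `T` in `Lie(G)`.
[cite: SpringerLAG1998, 8.1.1 (i) and 8.1.2] -/
theorem roots_subset_lieWeights [Infinite k] : roots G T ⊆ lieWeights G T := by
  rintro α ⟨hα1, hTG, u, hu⟩
  exact mem_lieWeights_iff.2 ⟨hα1, hu.exists_weightVector_mem_lieAlgebraGL⟩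

end Weights

end Literature.NumberTheory.Automorphic
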